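import Mathlib
import Summits.ValiantsHypothesis.ValiantsHypothesis.Theorems.BarrierLeverPartitionMinorsHitByVPHiddenStatesSecondShellEqualYRows

/-!
# Route BarrierLever — item `PartitionMinorsHitByVP` (stmt-ValiantsHypothesis-19717), line `hidden-states`:
# SECOND-SHELL «EQUAL-Y» CLASSES — the vanishing cross minor (swapped bottoms, cyclic digraph)

Helper file (`--supports stmt-ValiantsHypothesis-19717`; cell valiant-natproofs, 𝒟-side door (c), registered line
`Cruxes/PartitionMinorsHitByVP/Lines/hidden_states.lean` v8; prover seat val-np-p6 gen 17).  Closes NO item; definition-free.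

EQUAL-Y (memo §4 «three movers», toolkit `…SecondShellEqualYRows`): `C₁∖A₁ = C₂∖A₂ = {y_b,y_p,y_q}`, `A₁∖C₁ = {x₁,x₂}`,
`A₂∖C₂ = {q₁,q₂}`, `x₁ ∈ C₂` (an inert token of the start row), `x₂ ∉ C₂`, `x₂ ∉ {q₁,q₂}`.  Orientation with SWAPPED
BOTTOMS: path 1 = (y_b < y_p < y_q) with `x₁,x₂` attached at `y_b`, path 2 = (y_p < y_b < y_q) with `q₁,q₂` attached at
`y_p`.  With `Z = A₂ ∩ C₂`, for every parameter `(ε₀ε₁ − 1)·row(C₂) = Σ_T μ_T row(Z ∪ T)` over twenty rows none of which is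
`A₁` (the only pure-attachment pair is `Z ∪ {q₁,q₂} = A₂ ≠ A₁`), so `(ε₀ε₁−1)·D_{B−A₁+C₂} ≡ 0`, hence `D_{B−A₁+C₂} ≡ 0`
(`det_tab2_eq_zero_of_mul`).  THIS FILE: that vanishing, `equalY_cross_det_eq_zero`, for ANY row family containing the twenty rows and
`C₂`; the cell `…SecondShellEqualY.exists_table_secondShell_equalY` composes it with `…SecondShellExchange`.

HONEST LABEL: conjecture-column cells (second shell, every `t, h`); 19717 stays OPEN; nothing on crux 14610 or VP ≠ VNP.
-/

set_option linter.dupNamespace false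

namespace Summit.ValiantsHypothesis.ValiantsHypothesis.Theorems.BarrierLever.HiddenStates

open Finset

noncomputable section

namespace SecondShell

open PathTable

/-! ## The vanishing cross minor of the equal-Y class -/

/-- ★ for the swapped-bottom orientation of an equal-Y class (`x₁ ∈ C₂`, `x₂ ∉ C₂ ∪ {q₁,q₂}`), the cross minor through `C₂`
of ANY row family avoiding `A₁` but containing all other small sets vanishes for EVERY parameter. -/
theorem equalY_cross_det_eq_zero {h : ℕ} (t : ℕ) (A₁ A₂ C₁ C₂ : Finset (Fin h)) (hA₁ : A₁.card = t)
    (hC₂ : C₂.card = t + 1) (hA : A₁ ≠ A₂) {yb yp yq x₁ x₂ q₁ q₂ : Fin h}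
    (hY₁ : C₁ \ A₁ = {yb, yp, yq}) (hY₂ : C₂ \ A₂ = {yb, yp, yq}) (hbp : yb ≠ yp) (hbq : yb ≠ yq) (hpq : yp ≠ yq)
    (hx₁ : x₁ ∈ A₁ \ C₁) (hx₂ : x₂ ∈ A₁ \ C₁) (hX₂ : A₂ \ C₂ = {q₁, q₂}) (hq : q₁ ≠ q₂)
    (hx₁C : x₁ ∈ C₂) (hx₂C : x₂ ∉ C₂) (nxq₁ : x₂ ≠ q₁) (nxq₂ : x₂ ≠ q₂)
    {j₁ j₁' j₂ j₂' : ℕ} (e₁ : (Fin (2 + 1) ⊕ Fin 2) ⊕ (Fin j₁ ⊕ Fin j₁') ≃ Fin h)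
    (e₂ : (Fin (2 + 1) ⊕ Fin 2) ⊕ (Fin j₂ ⊕ Fin j₂') ≃ Fin h)
    (m1 : ∀ x, e₁ (Sum.inl (Sum.inl x)) ∈ C₁ \ A₁) (n1 : ∀ x, e₂ (Sum.inl (Sum.inl x)) ∈ C₂ \ A₂)
    (hbot₁ : e₁ (Sum.inl (Sum.inl 0)) = yb) (hmid₁ : e₁ (Sum.inl (Sum.inl 1)) = yp)
    (htop₁ : e₁ (Sum.inl (Sum.inl (Fin.last 2))) = yq) {i₀ i₀' : Fin 2} (hii₁ : i₀ ≠ i₀')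
    (hatt₁ : e₁ (Sum.inl (Sum.inr i₀)) = x₁) (hatt₁1 : e₁ (Sum.inl (Sum.inr i₀')) = x₂)
    (hbot₂ : e₂ (Sum.inl (Sum.inl 0)) = yp) (hmid₂ : e₂ (Sum.inl (Sum.inl 1)) = yb)
    (htop₂ : e₂ (Sum.inl (Sum.inl (Fin.last 2))) = yq) {l₀ l₀' : Fin 2} (hll : l₀ ≠ l₀')
    (hatt₂ : e₂ (Sum.inl (Sum.inr l₀)) = q₁) (hatt₂1 : e₂ (Sum.inl (Sum.inr l₀')) = q₂)
    {r : ℕ} (rows cols : Fin r → Finset (Fin h)) (i₁ : Fin r) (hrow : rows i₁ = C₂)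
    (key : ∀ S : Finset (Fin h), S.card ≤ t → S ≠ A₁ → ∃ i, i ≠ i₁ ∧ rows i = S)
    (hcolcard : ∀ kk, (cols kk).card ≤ t) :
    ∀ ε, (mat (tab2 (fun a q => swapTable' e₁ a q - if q = a then 1 else 0)
      (fun a q => swapTable' e₂ a q - if q = a then 1 else 0) ε) rows cols).det = 0 := by
  classical
  set N₁ : Fin h → Fin h → ℂ := fun a q => swapTable' e₁ a q - if q = a then 1 else 0 with hN₁
  set N₂ : Fin h → Fin h → ℂ := fun a q => swapTable' e₂ a q - if q = a then 1 else 0 with hN₂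
  have hY₂c : (C₂ \ A₂).card = 3 := by
    rw [hY₂, Finset.card_insert_of_notMem (by simp [hbp, hbq]), Finset.card_pair hpq]
  set Z : Finset (Fin h) := A₂ ∩ C₂ with hZdef
  have hZc : Z.card + 3 = t + 1 := by
    have h1 : (C₂ \ A₂).card + (C₂ ∩ A₂).card = C₂.card := Finset.card_sdiff_add_card_inter C₂ A₂
    have h2 : C₂ ∩ A₂ = Z := Finset.inter_comm C₂ A₂
    rw [hY₂c, hC₂, h2] at h1
    omega
  -- membership facts
  have hyb₁ : yb ∈ C₁ \ A₁ := by rw [hY₁]; simp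
  have hyq₁ : yq ∈ C₁ \ A₁ := by rw [hY₁]; simp
  have hyb₂ : yb ∈ C₂ \ A₂ := by rw [hY₂]; simp
  have hyp₂ : yp ∈ C₂ \ A₂ := by rw [hY₂]; simp
  have hyq₂ : yq ∈ C₂ \ A₂ := by rw [hY₂]; simp
  have hq₁ : q₁ ∈ A₂ \ C₂ := by rw [hX₂]; simp
  have hq₂ : q₂ ∈ A₂ \ C₂ := by rw [hX₂]; simp
  obtain ⟨⟨hybC, hybA⟩, ⟨hypC, hypA⟩, ⟨hyqC, hyqA⟩⟩ :=
    And.intro (Finset.mem_sdiff.1 hyb₂) (And.intro (Finset.mem_sdiff.1 hyp₂) (Finset.mem_sdiff.1 hyq₂))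
  obtain ⟨⟨hq₁A, hq₁C⟩, ⟨hq₂A, hq₂C⟩⟩ := And.intro (Finset.mem_sdiff.1 hq₁) (Finset.mem_sdiff.1 hq₂)
  obtain ⟨⟨hx₁A₁, hx₁C₁⟩, ⟨-, hx₂C₁⟩⟩ := And.intro (Finset.mem_sdiff.1 hx₁) (Finset.mem_sdiff.1 hx₂)
  have hybA₁ : yb ∉ A₁ := (Finset.mem_sdiff.1 hyb₁).2
  have hypA₁ : yp ∉ A₁ := by
    have : yp ∈ C₁ \ A₁ := by rw [hY₁]; simp
    exact (Finset.mem_sdiff.1 this).2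
  have hyqA₁ : yq ∉ A₁ := (Finset.mem_sdiff.1 hyq₁).2
  -- `x₁ ∈ Z`
  have hx₁A : x₁ ∈ A₂ := by
    by_contra h'
    have : x₁ ∈ C₂ \ A₂ := Finset.mem_sdiff.2 ⟨hx₁C, h'⟩
    rw [hY₂] at this
    simp only [Finset.mem_insert, Finset.mem_singleton] at this
    rcases this with rfl | rfl | rfl
    · exact hybA₁ hx₁A₁
    · exact hypA₁ hx₁A₁
    · exact hyqA₁ hx₁A₁
  have hx₁Z : x₁ ∈ Z := Finset.mem_inter.2 ⟨hx₁A, hx₁C⟩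
  -- distinctness
  have nbx : yb ≠ x₂ := fun h' => hx₂C (h' ▸ hybC)
  have npx : yp ≠ x₂ := fun h' => hx₂C (h' ▸ hypC)
  have nqx : yq ≠ x₂ := fun h' => hx₂C (h' ▸ hyqC)
  have nbq₁ : yb ≠ q₁ := fun h' => hq₁C (h' ▸ hybC)
  have nbq₂ : yb ≠ q₂ := fun h' => hq₂C (h' ▸ hybC)
  have npq₁ : yp ≠ q₁ := fun h' => hq₁C (h' ▸ hypC)
  have npq₂ : yp ≠ q₂ := fun h' => hq₂C (h' ▸ hypC)
  have nqq₁ : yq ≠ q₁ := fun h' => hq₁C (h' ▸ hyqC)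
  have nqq₂ : yq ≠ q₂ := fun h' => hq₂C (h' ▸ hyqC)
  have nbx₁ : yb ≠ x₁ := fun h' => hybA (h' ▸ hx₁A)
  have npx₁ : yp ≠ x₁ := fun h' => hypA (h' ▸ hx₁A)
  have nqx₁ : yq ≠ x₁ := fun h' => hyqA (h' ▸ hx₁A)
  -- non-membership in `Z`
  have hbZ : yb ∉ Z := fun h' => hybA (Finset.mem_inter.1 h').1
  have hpZ : yp ∉ Z := fun h' => hypA (Finset.mem_inter.1 h').1
  have hqZ : yq ∉ Z := fun h' => hyqA (Finset.mem_inter.1 h').1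
  have hxZ : x₂ ∉ Z := fun h' => hx₂C (Finset.mem_inter.1 h').2
  have hq₁Z : q₁ ∉ Z := fun h' => hq₁C (Finset.mem_inter.1 h').2
  have hq₂Z : q₂ ∉ Z := fun h' => hq₂C (Finset.mem_inter.1 h').2
  -- decompositions
  have hC₂eq : C₂ = insert yb (insert yp (insert yq Z)) := eq_insert₃_inter hY₂
  have hA₂eq : A₂ = insert q₁ (insert q₂ Z) := eq_insert₂_inter hX₂
  -- sizes of the relation rows
  have hins2 : ∀ a a' : Fin h, (insert a (insert a' Z)).card ≤ t := fun a a' => by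
    have := Finset.card_insert_le a (insert a' Z); have := Finset.card_insert_le a' Z; omega
  have hins1 : ∀ a : Fin h, (insert a Z).card ≤ t := fun a => by
    have := Finset.card_insert_le a Z; omega
  have hneA₁_of : ∀ (a : Fin h) (S : Finset (Fin h)), a ∉ A₁ → insert a S ≠ A₁ :=
    fun a S ha h' => ha (h' ▸ Finset.mem_insert_self a S)
  have hneA₁_1 : ∀ a : Fin h, insert a Z ≠ A₁ := fun a h' => by
    have h1 := Finset.card_insert_le a Z; rw [h', hA₁] at h1; omega
  have hneA₁_0 : Z ≠ A₁ := fun h' => by rw [h', hA₁] at hZc; omega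
  have hA₂' : insert q₁ (insert q₂ Z) ≠ A₁ := fun h' => hA (h'.symm.trans hA₂eq.symm)
  refine det_tab2_eq_zero_of_mul N₁ N₂ _ cols (MvPolynomial.X 0 * MvPolynomial.X 1 - 1) X0X1_sub_one_ne_zero ?_
  intro ε
  have hQ : MvPolynomial.eval ε (MvPolynomial.X 0 * MvPolynomial.X 1 - 1 : MvPolynomial (Fin 2) ℂ) = ε 0 * ε 1 - 1 := by
    simp
  rw [hQ]
  rcases eq_or_ne (ε 0 * ε 1 - 1) 0 with hq0 | hq0
  · rw [hq0, zero_mul]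
  rw [mul_eq_zero]; right
  set w : Fin h → Fin h → ℂ := tab2 N₁ N₂ ε with hw
  -- closed forms of the table rows
  have hr1b : ∀ q, swapTable' e₁ yb q =
      (if q = yb then 1 else 0) + (if q = x₁ then 1 else 0) + (if q = x₂ then 1 else 0) := by
    intro q
    have := row₂_bot e₁ i₀ i₀' hii₁ q
    rwa [hbot₁, hatt₁, hatt₁1] at this
  have hr1p : ∀ q, swapTable' e₁ yp q = (if q = yp then 1 else 0) + (if q = yb then 1 else 0) := by
    intro q; have := row₂_mid e₁ q; rwa [hmid₁, hbot₁] at this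
  have hr1q : ∀ q, swapTable' e₁ yq q = (if q = yq then 1 else 0) + (if q = yp then 1 else 0) := by
    intro q; have := row₂_top e₁ q; rwa [htop₁, hmid₁] at this
  have hr2p : ∀ q, swapTable' e₂ yp q =
      (if q = yp then 1 else 0) + (if q = q₁ then 1 else 0) + (if q = q₂ then 1 else 0) := by
    intro q
    have := row₂_bot e₂ l₀ l₀' hll q
    rwa [hbot₂, hatt₂, hatt₂1] at this
  have hr2b : ∀ q, swapTable' e₂ yb q = (if q = yb then 1 else 0) + (if q = yp then 1 else 0) := by
    intro q; have := row₂_mid e₂ q; rwa [hmid₂, hbot₂] at this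
  have hr2q : ∀ q, swapTable' e₂ yq q = (if q = yq then 1 else 0) + (if q = yb then 1 else 0) := by
    intro q; have := row₂_top e₂ q; rwa [htop₂, hmid₂] at this
  have hr1u : ∀ a, a ∉ C₁ \ A₁ → ∀ q, swapTable' e₁ a q = if q = a then 1 else 0 :=
    fun a ha => row_unit A₁ C₁ e₁ m1 ha
  have hr2u : ∀ a, a ∉ C₂ \ A₂ → ∀ q, swapTable' e₂ a q = if q = a then 1 else 0 :=
    fun a ha => row_unit A₂ C₂ e₂ n1 ha
  -- pointwise table entries
  have hwb : ∀ q, w yb q = (if q = yb then 1 else 0) + ε 0 * ((if q = x₁ then 1 else 0) + (if q = x₂ then 1 else 0))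
      + ε 1 * (if q = yp then 1 else 0) := by
    intro q; simp only [hw, tab2, hN₁, hN₂, hr1b q, hr2b q]; ring
  have hwp : ∀ q, w yp q = (if q = yp then 1 else 0) + ε 0 * (if q = yb then 1 else 0)
      + ε 1 * ((if q = q₁ then 1 else 0) + (if q = q₂ then 1 else 0)) := by
    intro q; simp only [hw, tab2, hN₁, hN₂, hr1p q, hr2p q]; ring
  have hwq : ∀ q, w yq q = (if q = yq then 1 else 0) + ε 0 * (if q = yp then 1 else 0) + ε 1 * (if q = yb then 1 else 0) := by
    intro q; simp only [hw, tab2, hN₁, hN₂, hr1q q, hr2q q]; ring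
  have hwu : ∀ a, a ∉ C₁ \ A₁ → a ∉ C₂ \ A₂ → ∀ q, w a q = if q = a then 1 else 0 := by
    intro a h1 h2 q; simp only [hw, tab2, hN₁, hN₂, hr1u a h1 q, hr2u a h2 q]; ring
  apply det_mat_eq_zero_of_rel' w (rows) cols i₁ (ε 0 * ε 1 - 1) hq0
    ![-(ε 0) ^ 2 * ε 1 + (ε 0) ^ 2 * (ε 1) ^ 2 - (ε 0) ^ 3 + (ε 0) ^ 3 * ε 1,
      ε 0 * ε 1 - ε 0 * (ε 1) ^ 2 + (ε 0) ^ 2 - (ε 0) ^ 2 * ε 1,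
      (ε 1) ^ 2 + 2 * ε 0 * ε 1 - ε 0 * (ε 1) ^ 2 + (ε 0) ^ 2 - (ε 0) ^ 2 * ε 1 - (ε 0) ^ 2 * (ε 1) ^ 2 - (ε 0) ^ 3 * ε 1,
      (ε 0) ^ 2 - (ε 0) ^ 2 * ε 1,
      -(ε 0) ^ 2 * ε 1 + (ε 0) ^ 2 * (ε 1) ^ 2 - (ε 0) ^ 3 + 3 * (ε 0) ^ 3 * ε 1 - 2 * (ε 0) ^ 4,
      -(ε 1) ^ 3 - (ε 1) ^ 4 - ε 0 * (ε 1) ^ 2 + 2 * ε 0 * (ε 1) ^ 3 - (ε 0) ^ 2 * ε 1 + (ε 0) ^ 2 * (ε 1) ^ 2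
        + (ε 0) ^ 2 * (ε 1) ^ 3,
      -(ε 1) ^ 3 - (ε 1) ^ 4 - ε 0 * (ε 1) ^ 2 + 2 * ε 0 * (ε 1) ^ 3 - (ε 0) ^ 2 * ε 1 + (ε 0) ^ 2 * (ε 1) ^ 2
        + (ε 0) ^ 2 * (ε 1) ^ 3,
      -(ε 1) - ε 0 + ε 0 * (ε 1) ^ 2 + (ε 0) ^ 2 * ε 1,
      -(ε 0) + ε 0 * ε 1,
      -(ε 0) ^ 2 * ε 1 + (ε 0) ^ 3,
      ε 0 * ε 1 - ε 0 * (ε 1) ^ 3,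
      ε 0 * ε 1 - ε 0 * (ε 1) ^ 3,
      -(ε 1) - ε 0 + ε 0 * ε 1 + (ε 0) ^ 2 * ε 1,
      ε 0 * ε 1 - (ε 0) ^ 3 * ε 1,
      (ε 1) ^ 3 - ε 0 * (ε 1) ^ 2,
      (ε 1) ^ 3 - ε 0 * (ε 1) ^ 2,
      (ε 0) ^ 2 - (ε 0) ^ 2 * ε 1,
      (ε 1) ^ 2 - ε 0 * (ε 1) ^ 2,
      (ε 1) ^ 2 - ε 0 * (ε 1) ^ 2,
      -2 * (ε 1) ^ 4 + 2 * ε 0 * (ε 1) ^ 3]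
    ![Z, insert yb Z, insert yp Z, insert yq Z, insert x₂ Z, insert q₁ Z, insert q₂ Z,
      insert yb (insert yp Z), insert yb (insert yq Z), insert yb (insert x₂ Z), insert yb (insert q₁ Z),
      insert yb (insert q₂ Z), insert yp (insert yq Z), insert yp (insert x₂ Z), insert yp (insert q₁ Z),
      insert yp (insert q₂ Z), insert yq (insert x₂ Z), insert yq (insert q₁ Z), insert yq (insert q₂ Z),
      insert q₁ (insert q₂ Z)]
  · intro l
    fin_cases l
    · exact key Z (show Z.card ≤ t by omega) hneA₁_0
    · exact key _ (hins1 yb) (hneA₁_1 yb)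
    · exact key _ (hins1 yp) (hneA₁_1 yp)
    · exact key _ (hins1 yq) (hneA₁_1 yq)
    · exact key _ (hins1 x₂) (hneA₁_1 x₂)
    · exact key _ (hins1 q₁) (hneA₁_1 q₁)
    · exact key _ (hins1 q₂) (hneA₁_1 q₂)
    · exact key _ (hins2 yb yp) (hneA₁_of yb _ hybA₁)
    · exact key _ (hins2 yb yq) (hneA₁_of yb _ hybA₁)
    · exact key _ (hins2 yb x₂) (hneA₁_of yb _ hybA₁)
    · exact key _ (hins2 yb q₁) (hneA₁_of yb _ hybA₁)
    · exact key _ (hins2 yb q₂) (hneA₁_of yb _ hybA₁)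
    · exact key _ (hins2 yp yq) (hneA₁_of yp _ hypA₁)
    · exact key _ (hins2 yp x₂) (hneA₁_of yp _ hypA₁)
    · exact key _ (hins2 yp q₁) (hneA₁_of yp _ hypA₁)
    · exact key _ (hins2 yp q₂) (hneA₁_of yp _ hypA₁)
    · exact key _ (hins2 yq x₂) (hneA₁_of yq _ hyqA₁)
    · exact key _ (hins2 yq q₁) (hneA₁_of yq _ hyqA₁)
    · exact key _ (hins2 yq q₂) (hneA₁_of yq _ hyqA₁)
    · exact key _ (hins2 q₁ q₂) hA₂'
  · intro kk
    rw [hrow]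
    simp only [Fin.sum_univ_succ, Fin.sum_univ_zero, Matrix.cons_val_zero, Matrix.cons_val_succ, add_zero]
    set J := cols kk with hJ
    set Y : Fin h → ℂ := fun a => ∑ q ∈ J, w a q with hY
    set Φ : ℂ := ∏ a ∈ Z, Y a with hΦ
    have hP2 : ∀ a a' : Fin h, a ≠ a' → a ∉ Z → a' ∉ Z →
        ∏ x ∈ insert a (insert a' Z), Y x = Y a * (Y a' * Φ) := by
      intro a a' h1 h2 h3
      rw [Finset.prod_insert (by simp only [Finset.mem_insert, not_or]; exact ⟨h1, h2⟩), Finset.prod_insert h3]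
    have hP1 : ∀ a : Fin h, a ∉ Z → ∏ x ∈ insert a Z, Y x = Y a * Φ := by
      intro a h2; rw [Finset.prod_insert h2]
    have hP3 : ∏ x ∈ C₂, Y x = Y yb * (Y yp * (Y yq * Φ)) := by
      rw [hC₂eq, Finset.prod_insert (by simp only [Finset.mem_insert, not_or]; exact ⟨hbp, hbq, hbZ⟩),
        Finset.prod_insert (by simp only [Finset.mem_insert, not_or]; exact ⟨hpq, hpZ⟩), Finset.prod_insert hqZ]
    rw [hP3, hP1 yb hbZ, hP1 yp hpZ, hP1 yq hqZ, hP1 x₂ hxZ, hP1 q₁ hq₁Z, hP1 q₂ hq₂Z,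
      hP2 yb yp hbp hbZ hpZ, hP2 yb yq hbq hbZ hqZ, hP2 yb x₂ nbx hbZ hxZ, hP2 yb q₁ nbq₁ hbZ hq₁Z,
      hP2 yb q₂ nbq₂ hbZ hq₂Z, hP2 yp yq hpq hpZ hqZ, hP2 yp x₂ npx hpZ hxZ, hP2 yp q₁ npq₁ hpZ hq₁Z,
      hP2 yp q₂ npq₂ hpZ hq₂Z, hP2 yq x₂ nqx hqZ hxZ, hP2 yq q₁ nqq₁ hqZ hq₁Z, hP2 yq q₂ nqq₂ hqZ hq₂Z,
      hP2 q₁ q₂ hq hq₁Z hq₂Z]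
    -- the indicators
    set nb : ℕ := if yb ∈ J then 1 else 0 with hnb
    set np : ℕ := if yp ∈ J then 1 else 0 with hnp
    set nq : ℕ := if yq ∈ J then 1 else 0 with hnq
    set nx1 : ℕ := if x₁ ∈ J then 1 else 0 with hnx1
    set nx : ℕ := if x₂ ∈ J then 1 else 0 with hnx
    set nu : ℕ := if q₁ ∈ J then 1 else 0 with hnu
    set nv : ℕ := if q₂ ∈ J then 1 else 0 with hnv
    have hI : ∀ (a : Fin h), (∑ q ∈ J, (if q = a then (1 : ℂ) else 0)) = ((if a ∈ J then 1 else 0 : ℕ) : ℂ) := by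
      intro a; rw [Finset.sum_ite_eq']; split_ifs <;> simp
    have hYb : Y yb = (nb : ℂ) + ε 0 * ((nx1 : ℂ) + (nx : ℂ)) + ε 1 * (np : ℂ) := by
      simp only [hY, hnb, hnx1, hnx, hnp]
      rw [Finset.sum_congr rfl (fun q _ => hwb q), Finset.sum_add_distrib, Finset.sum_add_distrib, ← Finset.mul_sum,
        ← Finset.mul_sum, Finset.sum_add_distrib, hI, hI, hI, hI]
    have hYp : Y yp = (np : ℂ) + ε 0 * (nb : ℂ) + ε 1 * ((nu : ℂ) + (nv : ℂ)) := by
      simp only [hY, hnp, hnb, hnu, hnv]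
      rw [Finset.sum_congr rfl (fun q _ => hwp q), Finset.sum_add_distrib, Finset.sum_add_distrib, ← Finset.mul_sum,
        ← Finset.mul_sum, Finset.sum_add_distrib, hI, hI, hI, hI]
    have hYq : Y yq = (nq : ℂ) + ε 0 * (np : ℂ) + ε 1 * (nb : ℂ) := by
      simp only [hY, hnq, hnp, hnb]
      rw [Finset.sum_congr rfl (fun q _ => hwq q), Finset.sum_add_distrib, Finset.sum_add_distrib, ← Finset.mul_sum,
        ← Finset.mul_sum, hI, hI, hI]
    have hYu : ∀ a, a ∉ C₁ \ A₁ → a ∉ C₂ \ A₂ → Y a = ((if a ∈ J then 1 else 0 : ℕ) : ℂ) := by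
      intro a h1 h2
      simp only [hY]
      rw [Finset.sum_congr rfl (fun q _ => hwu a h1 h2 q), hI]
    have hx' : x₂ ∉ C₁ \ A₁ := fun h' => hx₂C₁ (Finset.mem_sdiff.1 h').1
    have hx'' : x₂ ∉ C₂ \ A₂ := fun h' => hx₂C (Finset.mem_sdiff.1 h').1
    have hq₁' : q₁ ∉ C₁ \ A₁ := by rw [hY₁]; simp [nbq₁.symm, npq₁.symm, nqq₁.symm]
    have hq₂' : q₂ ∉ C₁ \ A₁ := by rw [hY₁]; simp [nbq₂.symm, npq₂.symm, nqq₂.symm]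
    have hq₁'' : q₁ ∉ C₂ \ A₂ := fun h' => hq₁C (Finset.mem_sdiff.1 h').1
    have hq₂'' : q₂ ∉ C₂ \ A₂ := fun h' => hq₂C (Finset.mem_sdiff.1 h').1
    have hYx : Y x₂ = (nx : ℂ) := by rw [hYu x₂ hx' hx'', hnx]
    have hYq₁ : Y q₁ = (nu : ℂ) := by rw [hYu q₁ hq₁' hq₁'', hnu]
    have hYq₂ : Y q₂ = (nv : ℂ) := by rw [hYu q₂ hq₂' hq₂'', hnv]
    rw [hYx, hYq₁, hYq₂]
    -- trivial if some inert token of `Z` is outside `J`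
    rcases eq_or_ne Φ 0 with h0 | h0
    · rw [h0]; ring
    -- otherwise `Z ⊆ J` (so `x₁ ∈ J`), and at most two of the six free nodes are in `J`
    have hZu : ∀ a ∈ Z, a ∉ C₁ \ A₁ ∧ a ∉ C₂ \ A₂ := by
      intro a ha
      have ha' := Finset.mem_inter.1 ha
      refine ⟨?_, fun h' => (Finset.mem_sdiff.1 h').2 ha'.1⟩
      rw [hY₁]; simp only [Finset.mem_insert, Finset.mem_singleton, not_or]
      refine ⟨?_, ?_, ?_⟩
      · rintro rfl; exact hbZ ha
      · rintro rfl; exact hpZ ha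
      · rintro rfl; exact hqZ ha
    have hZJ : Z ⊆ J := by
      intro a ha
      by_contra haJ
      apply h0
      apply Finset.prod_eq_zero ha
      rw [hYu a (hZu a ha).1 (hZu a ha).2, if_neg haJ, Nat.cast_zero]
    have hnx1 : nx1 = 1 := by simp only [hnx1]; exact if_pos (hZJ hx₁Z)
    have hYb' : Y yb = (nb : ℂ) + ε 0 * (1 + (nx : ℂ)) + ε 1 * (np : ℂ) := by rw [hYb, hnx1, Nat.cast_one]
    have hle : nb + np + nq + nx + nu + nv ≤ 2 := by
      have hsub : (({yb, yp, yq, x₂, q₁, q₂} : Finset (Fin h)).filter (· ∈ J)) ⊆ J \ Z := by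
        intro a ha
        rw [Finset.mem_filter] at ha
        simp only [Finset.mem_insert, Finset.mem_singleton] at ha
        refine Finset.mem_sdiff.2 ⟨ha.2, ?_⟩
        rcases ha.1 with rfl | rfl | rfl | rfl | rfl | rfl
        · exact hbZ
        · exact hpZ
        · exact hqZ
        · exact hxZ
        · exact hq₁Z
        · exact hq₂Z
      have hcard := Finset.card_le_card hsub
      rw [Finset.card_sdiff_of_subset hZJ, Finset.card_filter] at hcard
      rw [Finset.sum_insert (by simp [hbp, hbq, nbx, nbq₁, nbq₂]), Finset.sum_insert (by simp [hpq, npx, npq₁, npq₂]),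
        Finset.sum_insert (by simp [nqx, nqq₁, nqq₂]), Finset.sum_insert (by simp [nxq₁, nxq₂]),
        Finset.sum_pair hq] at hcard
      have hJc : J.card ≤ t := hcolcard kk
      simp only [hnb, hnp, hnq, hnx, hnu, hnv]
      omega
    have h01 : ∀ (P : Prop) [Decidable P], (if P then 1 else 0 : ℕ) = 0 ∨ (if P then 1 else 0 : ℕ) = 1 := by
      intro P _; by_cases hP : P
      · exact Or.inr (if_pos hP)
      · exact Or.inl (if_neg hP)
    have hid := equalY_budget_identity (ε 0) (ε 1) nb np nq nx nu nv (h01 _) (h01 _) (h01 _) (h01 _) (h01 _) (h01 _)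
      hle (Y yb) (Y yp) (Y yq) hYb' hYp hYq
    linear_combination Φ * hid

end SecondShell

end

end Summit.ValiantsHypothesis.ValiantsHypothesis.Theorems.BarrierLever.HiddenStates
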